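import Literature.Analysis.FluidPDE.NSRobustnessOfRegularity
import Literature.Analysis.FluidPDE.TaoSpeedContinuation
import HarnessLib

/-!
# Route `EfficiencyFloor`, support `RigidExit` (stmt-NavierStokesRegularity-25513) on the `ProductionEfficiencyDecay` ladder
# (stmt-NavierStokesRegularity-22866): ROBUSTNESS OF REGULARITY WITH THE PRINTED (SLICEWISE AGMON) RATE

Helper file (`--supports stmt-NavierStokesRegularity-22866`; line `efficiency_floor`). The typed residue (R-shadow) of
`RigidExit` (`ReferenceShadowing.earlyDeficit_of_referenceShadowing`, p839834/p839853; census of hand g24, items 2–3) is an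
application of the tree's `H¹` robustness-of-regularity estimate (Robinson–Rodrigo–Sadowski 2016, Thm 9.1, a priori form;
`Literature.Analysis.FluidPDE.classicalNS_robustness_apriori_R3`) with REFERENCE = Leray's flow `v` through a normalised
maximiser on a window `[δ, η·W]`, followed by `δ → 0⁺`. Uniformity of the Grönwall exponent in `δ` (the datum is only `H²`, the
sup of `v` is not controlled up to `t = 0`) forces the rate of the printed proof, (9.3):
`α(s) = c(‖∇v(s)‖⁴ + ‖∇v(s)‖‖Δv(s)‖)` — i.e. the sup of the reference entering SLICE BY SLICE through Agmon,
`‖v(s)‖²_∞ ≤ A²‖∇v(s)‖‖Δv(s)‖`, whose time integral is controlled by the dissipation budget — and not the constant-`M` instance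
`classicalNS_robustness_of_regularity_R3` of the tree. This file supplies that instance, forcing-free, in the shape (R-shadow) consumes:

* `sobolev_sub`, `hasDerivWithinAt_intervalIntegral_Icc` — bookkeeping (slicewise Sobolev bounds of a difference; FTC within `[0,T]`);
* `robustness_slab` — on `[0,T]`: two classical solutions `(v,q)`, `(u,p)` (zero force) in the `L²`-Sobolev class, a continuous rate
  `l ≥ 0` with, at each slice, SOME `M ≥ ‖u(s)‖_∞` such that `2M²/ν + 27A⁴(∫|∇u(s)|²_F)²/(2ν³) ≤ l(s)`, `Λ' = l`, `Λ(0) = 0`,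
  `β = 27A⁴/(2ν³)`: if `2βe^{2Λ(T)}X(0)²T < 1` then `X(t) ≤ e^{Λ(t)}X(0)/√(1 − 2βe^{2Λ(T)}X(0)²t)`, `X(t) = ∫|∇(v−u)(t)|²_F`;
* `robustness_window_of_le` — the same on a window `[t₀,t₁]` with MAJORANTS: `X(t₀) ≤ D`, `∫_{t₀}^{t₁} l ≤ Λ₁`,
  `2βe^{2Λ₁}D²(t₁−t₀) < 1` ⟹ `X(t) ≤ e^{Λ₁}D/√(1 − 2βe^{2Λ₁}D²(t₁−t₀))` on `[t₀,t₁]` (time translation + monotonicity).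

HONEST FRAMING: continuous dependence between two GIVEN smooth solutions (RRS Thm 9.1, a priori half); (R-shadow), `RigidExit`,
`NearMaximiserBoundedAmplification`, `LerayFloorGap`, `ProductionEfficiencyDecay` (stmt-22866) and Navier–Stokes regularity stay
OPEN; no summit statement is proved. [cite: RobinsonRodrigoSadowskiCUP2016, Thm 9.1, proof (9.2)–(9.5)]
-/

-- the problem directory repeats the summit name (`NavierStokesRegularity/NavierStokesRegularity`)
set_option linter.dupNamespace false

noncomputable section

open Set Filter MeasureTheory Topology Function InnerProductSpace
open scoped InnerProductSpace RealInnerProductSpace ENNReal NNReal ContDiff Laplacian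
open Literature.Analysis.FluidPDE

namespace Summit.NavierStokesRegularity.NavierStokesRegularity.Theorems

namespace RigidExit

namespace ReferenceShadowing

section Robustness

variable {ν T : ℝ} {u v : ℝ → EuclideanSpace ℝ (Fin 3) → EuclideanSpace ℝ (Fin 3)}
  {p q : ℝ → EuclideanSpace ℝ (Fin 3) → ℝ}

/-- Uniform `L²`-Sobolev bounds pass to slicewise differences of smooth slices. [folklore] -/
theorem sobolev_sub {F : Type*} [NormedAddCommGroup F] [NormedSpace ℝ F]
    {S : Set ℝ} {a b : ℝ → EuclideanSpace ℝ (Fin 3) → F}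
    (ha : ∀ t ∈ S, ContDiff ℝ ∞ (a t)) (hb : ∀ t ∈ S, ContDiff ℝ ∞ (b t))
    (hA : ∀ n : ℕ, ∃ C : ℝ≥0, ∀ t ∈ S, ∫⁻ x, ‖iteratedFDeriv ℝ n (a t) x‖ₑ ^ 2 ≤ C)
    (hB : ∀ n : ℕ, ∃ C : ℝ≥0, ∀ t ∈ S, ∫⁻ x, ‖iteratedFDeriv ℝ n (b t) x‖ₑ ^ 2 ≤ C) (n : ℕ) :
    ∃ C : ℝ≥0, ∀ t ∈ S, ∫⁻ x, ‖iteratedFDeriv ℝ n ((a - b) t) x‖ₑ ^ 2 ≤ C := by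
  obtain ⟨Ca, hCa⟩ := hA n
  obtain ⟨Cb, hCb⟩ := hB n
  refine ⟨2 * Ca + 2 * Cb, fun t ht => ?_⟩
  have hc : (a - b) t = a t - b t := rfl
  have hsub : ∀ x, iteratedFDeriv ℝ n ((a - b) t) x = iteratedFDeriv ℝ n (a t) x - iteratedFDeriv ℝ n (b t) x :=
    fun x => by
      rw [hc]
      exact iteratedFDeriv_sub_apply ((ha t ht).of_le (by exact_mod_cast le_top)).contDiffAt
        ((hb t ht).of_le (by exact_mod_cast le_top)).contDiffAt
  have hm : AEStronglyMeasurable (fun x => iteratedFDeriv ℝ n (a t) x) volume :=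
    ((ha t ht).continuous_iteratedFDeriv (by exact_mod_cast le_top)).aestronglyMeasurable
  calc ∫⁻ x, ‖iteratedFDeriv ℝ n ((a - b) t) x‖ₑ ^ 2
      = ∫⁻ x, ‖iteratedFDeriv ℝ n (a t) x - iteratedFDeriv ℝ n (b t) x‖ₑ ^ 2 :=
        lintegral_congr fun x => by rw [hsub]
    _ ≤ 2 * (∫⁻ x, ‖iteratedFDeriv ℝ n (a t) x‖ₑ ^ 2) + 2 * ∫⁻ x, ‖iteratedFDeriv ℝ n (b t) x‖ₑ ^ 2 :=
        lintegral_enorm_sq_sub_le hm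
    _ ≤ 2 * (Ca : ℝ≥0∞) + 2 * (Cb : ℝ≥0∞) := by
        gcongr
        · exact hCa t ht
        · exact hCb t ht
    _ = ((2 * Ca + 2 * Cb : ℝ≥0) : ℝ≥0∞) := by push_cast; rfl

/-- FTC within `[0, T]`: for `φ` continuous on `[0, T]`, `r ↦ ∫₀ʳ φ` has the one-sided derivative `φ(t)` within `[0, T]`
at every `t ∈ [0, T]`. [folklore] -/
theorem hasDerivWithinAt_intervalIntegral_Icc {φ : ℝ → ℝ} {T t : ℝ}
    (hφ : ContinuousOn φ (Icc 0 T)) (ht : t ∈ Icc 0 T) :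
    HasDerivWithinAt (fun r => ∫ x in (0 : ℝ)..r, φ x) (φ t) (Icc 0 T) t := by
  haveI : Fact (t ∈ Icc 0 T) := ⟨ht⟩
  have hint : IntervalIntegrable φ volume 0 t :=
    (hφ.mono (Icc_subset_Icc_right ht.2)).intervalIntegrable_of_Icc ht.1
  exact intervalIntegral.integral_hasDerivWithinAt_right hint
    (hφ.stronglyMeasurableAtFilter_nhdsWithin measurableSet_Icc t) (hφ t ht)

/-- Slicewise Sobolev bounds translate in time. [folklore] -/
theorem bounds_comp_add {G' : Type*} [NormedAddCommGroup G'] [NormedSpace ℝ G']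
    {w : ℝ → EuclideanSpace ℝ (Fin 3) → G'} {a b s : ℝ}
    (h : ∀ n : ℕ, ∃ C : ℝ≥0, ∀ t ∈ Icc (a + s) (b + s), ∫⁻ x, ‖iteratedFDeriv ℝ n (w t) x‖ₑ ^ 2 ≤ C) :
    ∀ n : ℕ, ∃ C : ℝ≥0, ∀ t ∈ Icc a b, ∫⁻ x, ‖iteratedFDeriv ℝ n (w (t + s)) x‖ₑ ^ 2 ≤ C :=
  fun n => (h n).imp fun _ hC t ht => hC (t + s) ⟨by linarith [ht.1], by linarith [ht.2]⟩

/-- **Robustness of regularity on `ℝ³` with the printed rate (9.3), a priori, forcing-free.** Let `(v,q)` and `(u,p)` (the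
reference) be classical Navier–Stokes solutions on `[0,T] × ℝ³` in the `L²`-Sobolev class, and let `l` be continuous on
`[0,T]` with, at every slice, some `M ≥ 0`, `‖u(s,·)‖ ≤ M`, such that `2M²/ν + 27A⁴(∫|∇u(s)|²_F)²/(2ν³) ≤ l(s)`
(`A = agmonConst`; e.g. `M = A(∫|∇u(s)|²_F ∫‖Δu(s)‖²)^{1/4}` by Agmon, the book's `‖∇u‖‖Au‖`). Put `Λ' = l`, `Λ(0) = 0`,
`β = 27A⁴/(2ν³)`, `X(t) = ∫|∇(v−u)(t)|²_F`. If `2βe^{2Λ(T)}X(0)²T < 1` then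
`X(t) ≤ e^{Λ(t)}X(0)/√(1 − 2βe^{2Λ(T)}X(0)²t)` for `t ∈ [0,T]`.
[cite: RobinsonRodrigoSadowskiCUP2016, Thm 9.1, proof (9.2)–(9.5)] -/
theorem robustness_slab (hν : 0 < ν) (hT : 0 < T)
    (hv : IsClassicalNSSolutionOn (Icc 0 T) ν 0 v q) (hu : IsClassicalNSSolutionOn (Icc 0 T) ν 0 u p)
    (hU : HasBoundedSobolevNormsOn (Icc 0 T) u)
    (hUt : HasBoundedSobolevNormsOn (Icc 0 T) (timeDerivWithin (Icc 0 T) u))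
    (hp : ∀ n : ℕ, ∃ C : ℝ≥0, ∀ t ∈ Icc 0 T, ∫⁻ x, ‖iteratedFDeriv ℝ n (p t) x‖ₑ ^ 2 ≤ C)
    (hV : HasBoundedSobolevNormsOn (Icc 0 T) v)
    (hVt : HasBoundedSobolevNormsOn (Icc 0 T) (timeDerivWithin (Icc 0 T) v))
    (hq : ∀ n : ℕ, ∃ C : ℝ≥0, ∀ t ∈ Icc 0 T, ∫⁻ x, ‖iteratedFDeriv ℝ n (q t) x‖ₑ ^ 2 ≤ C)
    {l Λ : ℝ → ℝ} (hlc : ContinuousOn l (Icc 0 T))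
    (hl : ∀ s ∈ Icc 0 T, ∃ M : ℝ, 0 ≤ M ∧ (∀ x, ‖u s x‖ ≤ M) ∧
      2 * M ^ 2 / ν + 27 * agmonConst ^ 4 * (∫ x, frobeniusNormSq (fderiv ℝ (u s) x)) ^ 2 / (2 * ν ^ 3) ≤ l s)
    (hΛ : ∀ s ∈ Icc 0 T, HasDerivWithinAt Λ (l s) (Icc 0 T) s) (hΛ0 : Λ 0 = 0)
    (hsmall : 2 * (27 * agmonConst ^ 4 / (2 * ν ^ 3) * Real.exp (2 * Λ T)) *
      (∫ x, frobeniusNormSq (fderiv ℝ ((v - u) 0) x)) ^ 2 * T < 1)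
    {t : ℝ} (ht : t ∈ Icc 0 T) :
    ∫ x, frobeniusNormSq (fderiv ℝ ((v - u) t) x) ≤
      Real.exp (Λ t) * (∫ x, frobeniusNormSq (fderiv ℝ ((v - u) 0) x)) /
        Real.sqrt (1 - 2 * (27 * agmonConst ^ 4 / (2 * ν ^ 3) * Real.exp (2 * Λ T)) *
          (∫ x, frobeniusNormSq (fderiv ℝ ((v - u) 0) x)) ^ 2 * t) := by
  -- smoothness and Sobolev data of the difference
  have hwsm : IsSmoothSpaceTimeOn (Icc 0 T) (v - u) := hv.smooth_velocity.sub hu.smooth_velocity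
  have hwsob : ∀ n : ℕ, ∃ C : ℝ≥0, ∀ s ∈ Icc 0 T, ∫⁻ x, ‖iteratedFDeriv ℝ n ((v - u) s) x‖ₑ ^ 2 ≤ C :=
    sobolev_sub (fun s hs => hv.contDiff_velocity hs) (fun s hs => hu.contDiff_velocity hs) hV hU
  have hfin : ∀ s ∈ Icc 0 T, ∀ n : ℕ, ∫⁻ x, ‖iteratedFDeriv ℝ n ((v - u) s) x‖ₑ ^ 2 < ⊤ := fun s hs n => by
    obtain ⟨C, hC⟩ := hwsob n
    exact (hC s hs).trans_lt ENNReal.coe_lt_top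
  -- `∫|∇u(s)|²_F` finite on slices
  have hu1F : ∀ s ∈ Icc 0 T, ∫⁻ x, ENNReal.ofReal (frobeniusNormSq (fderiv ℝ (u s) x)) < ⊤ := by
    intro s hs
    obtain ⟨C₁, hC₁⟩ := hU 1
    calc ∫⁻ x, ENNReal.ofReal (frobeniusNormSq (fderiv ℝ (u s) x))
        ≤ ∫⁻ x, 3 * ‖iteratedFDeriv ℝ 1 (u s) x‖ₑ ^ 2 := lintegral_mono fun x => by
          rw [← ofReal_norm, norm_iteratedFDeriv_one, ofReal_norm]
          exact ofReal_frobeniusNormSq_le_three_mul_enorm_sq _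
      _ = 3 * ∫⁻ x, ‖iteratedFDeriv ℝ 1 (u s) x‖ₑ ^ 2 := lintegral_const_mul' _ _ (by norm_num)
      _ < ⊤ := ENNReal.mul_lt_top (by norm_num) ((hC₁ s hs).trans_lt ENNReal.coe_lt_top)
  have hl0 : ∀ s ∈ Icc 0 T, 0 ≤ l s := fun s hs => by
    obtain ⟨M, hM0, -, hle⟩ := hl s hs
    have hA := agmonConst_nonneg
    have : 0 ≤ 2 * M ^ 2 / ν + 27 * agmonConst ^ 4 * (∫ x, frobeniusNormSq (fderiv ℝ (u s) x)) ^ 2 / (2 * ν ^ 3) := by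
      positivity
    linarith
  -- the slice bound with the slicewise rate along the two solutions
  have hflux : ∀ s ∈ Icc 0 T,
      -(2 * ν * ∫ x, ‖(Δ ((v - u) s)) x‖ ^ 2) +
          2 * (∫ x, ⟪convect (v s) ((v - u) s) x + convect ((v - u) s) (u s) x,
            (Δ ((v - u) s)) x⟫) +
          2 * (∫ x, ⟪(0 : ℝ → EuclideanSpace ℝ (Fin 3) → EuclideanSpace ℝ (Fin 3)) s x -
            (0 : ℝ → EuclideanSpace ℝ (Fin 3) → EuclideanSpace ℝ (Fin 3)) s x, (Δ ((v - u) s)) x⟫) ≤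
        l s * (∫ x, frobeniusNormSq (fderiv ℝ ((v - u) s) x)) +
          27 * agmonConst ^ 4 / (2 * ν ^ 3) * (∫ x, frobeniusNormSq (fderiv ℝ ((v - u) s) x)) ^ 3 +
          (fun _ : ℝ => (0 : ℝ)) s := by
    intro s hs
    obtain ⟨M, hM0, hM, hle⟩ := hl s hs
    have hw : ContDiff ℝ ∞ ((v - u) s) := hwsm.contDiff_slice hs
    have ch : Continuous fun _ : EuclideanSpace ℝ (Fin 3) => (0 : EuclideanSpace ℝ (Fin 3)) := continuous_const
    have hh0 : ∫⁻ _ : EuclideanSpace ℝ (Fin 3), ‖(0 : EuclideanSpace ℝ (Fin 3))‖ₑ ^ 2 < ⊤ := by simp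
    have key := robustness_flux_le_R3 hν (hu.contDiff_velocity hs) hw ch
      (hfin s hs 0) (hfin s hs 1) (hfin s hs 2) (hfin s hs 3) (hu1F s hs) hh0 hM0 hM
    have e : (fun y => u s y + (v - u) s y) = v s := by
      funext y
      simp only [Pi.sub_apply]
      abel
    rw [e] at key
    have hz1 : (∫ x, ⟪(0 : EuclideanSpace ℝ (Fin 3)), (Δ ((v - u) s)) x⟫) = 0 := by simp
    have hz2 : (∫ x, ⟪(0 : ℝ → EuclideanSpace ℝ (Fin 3) → EuclideanSpace ℝ (Fin 3)) s x -
        (0 : ℝ → EuclideanSpace ℝ (Fin 3) → EuclideanSpace ℝ (Fin 3)) s x, (Δ ((v - u) s)) x⟫) = 0 := by simp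
    have hz3 : (∫ _ : EuclideanSpace ℝ (Fin 3), ‖(0 : EuclideanSpace ℝ (Fin 3))‖ ^ 2) = 0 := by simp
    rw [hz1, hz3] at key
    rw [hz2]
    have hX0 : 0 ≤ ∫ x, frobeniusNormSq (fderiv ℝ ((v - u) s) x) := integral_nonneg fun x => frobeniusNormSq_nonneg _
    have hprod : (2 * M ^ 2 / ν + 27 * agmonConst ^ 4 * (∫ x, frobeniusNormSq (fderiv ℝ (u s) x)) ^ 2 / (2 * ν ^ 3)) *
        (∫ x, frobeniusNormSq (fderiv ℝ ((v - u) s) x)) ≤ l s * (∫ x, frobeniusNormSq (fderiv ℝ ((v - u) s) x)) :=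
      mul_le_mul_of_nonneg_right hle hX0
    generalize (∫ x, frobeniusNormSq (fderiv ℝ ((v - u) s) x)) = X at key hprod ⊢
    generalize (∫ x, frobeniusNormSq (fderiv ℝ (u s) x)) = Gu at key hprod ⊢
    generalize (∫ x, ‖(Δ ((v - u) s)) x‖ ^ 2) = Y at key ⊢
    generalize (∫ x, ⟪convect (v s) ((v - u) s) x + convect ((v - u) s) (u s) x,
      (Δ ((v - u) s)) x⟫) = Pa at key ⊢
    have hid : 27 * agmonConst ^ 4 * X ^ 3 / (2 * ν ^ 3) = 27 * agmonConst ^ 4 / (2 * ν ^ 3) * X ^ 3 := by ring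
    simp only
    linarith
  have hβ : 0 ≤ 27 * agmonConst ^ 4 / (2 * ν ^ 3) := by
    have := agmonConst_nonneg
    positivity
  have key := classicalNS_robustness_apriori_R3 hT hv hu hU hUt hp hV hVt hq hβ hlc
    (ψ := fun _ => (0 : ℝ)) continuousOn_const hl0 (fun _ _ => le_rfl) hflux hΛ hΛ0
    (Φ := fun _ => (0 : ℝ)) (φ := fun _ => (0 : ℝ)) (fun s _ => hasDerivWithinAt_const s (Icc 0 T) (0 : ℝ)) rfl
    (fun s _ => by simp) (by simpa only [add_zero] using hsmall) ht
  simpa only [add_zero] using key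

/-- **Window form with majorants** (the shape (R-shadow) consumes). Let `(v,q)`, `(u,p)` (the reference) be classical
forcing-free solutions on `[t₀,t₁] × ℝ³`, `t₀ < t₁`, in the `L²`-Sobolev class, and `l` continuous on `[t₀,t₁]` with, at each
slice, some `M ≥ 0`, `‖u(s,·)‖ ≤ M`, `2M²/ν + 27A⁴(∫|∇u(s)|²_F)²/(2ν³) ≤ l(s)`. If `∫|∇(v−u)(t₀)|²_F ≤ D`, `∫_{t₀}^{t₁} l ≤ Λ₁` and
`2βe^{2Λ₁}D²(t₁−t₀) < 1` (`β = 27A⁴/(2ν³)`), then for every `t ∈ [t₀,t₁]`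
`∫|∇(v−u)(t)|²_F ≤ e^{Λ₁}D/√(1 − 2βe^{2Λ₁}D²(t₁−t₀))`. [cite: RobinsonRodrigoSadowskiCUP2016, Thm 9.1, proof (9.2)–(9.5)] -/
theorem robustness_window_of_le (hν : 0 < ν) {t₀ t₁ : ℝ} (ht₀₁ : t₀ < t₁)
    (hv : IsClassicalNSSolutionOn (Icc t₀ t₁) ν 0 v q) (hu : IsClassicalNSSolutionOn (Icc t₀ t₁) ν 0 u p)
    (hU : HasBoundedSobolevNormsOn (Icc t₀ t₁) u)
    (hUt : HasBoundedSobolevNormsOn (Icc t₀ t₁) (timeDerivWithin (Icc t₀ t₁) u))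
    (hp : ∀ n : ℕ, ∃ C : ℝ≥0, ∀ t ∈ Icc t₀ t₁, ∫⁻ x, ‖iteratedFDeriv ℝ n (p t) x‖ₑ ^ 2 ≤ C)
    (hV : HasBoundedSobolevNormsOn (Icc t₀ t₁) v)
    (hVt : HasBoundedSobolevNormsOn (Icc t₀ t₁) (timeDerivWithin (Icc t₀ t₁) v))
    (hq : ∀ n : ℕ, ∃ C : ℝ≥0, ∀ t ∈ Icc t₀ t₁, ∫⁻ x, ‖iteratedFDeriv ℝ n (q t) x‖ₑ ^ 2 ≤ C)
    {l : ℝ → ℝ} (hlc : ContinuousOn l (Icc t₀ t₁))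
    (hl : ∀ s ∈ Icc t₀ t₁, ∃ M : ℝ, 0 ≤ M ∧ (∀ x, ‖u s x‖ ≤ M) ∧
      2 * M ^ 2 / ν + 27 * agmonConst ^ 4 * (∫ x, frobeniusNormSq (fderiv ℝ (u s) x)) ^ 2 / (2 * ν ^ 3) ≤ l s)
    {D Λ₁ : ℝ} (hD : (∫ x, frobeniusNormSq (fderiv ℝ ((v - u) t₀) x)) ≤ D)
    (hΛ₁ : (∫ s in t₀..t₁, l s) ≤ Λ₁)
    (hsmall : 2 * (27 * agmonConst ^ 4 / (2 * ν ^ 3) * Real.exp (2 * Λ₁)) * D ^ 2 * (t₁ - t₀) < 1)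
    {t : ℝ} (ht : t ∈ Icc t₀ t₁) :
    ∫ x, frobeniusNormSq (fderiv ℝ ((v - u) t) x) ≤
      Real.exp Λ₁ * D / Real.sqrt (1 - 2 * (27 * agmonConst ^ 4 / (2 * ν ^ 3) * Real.exp (2 * Λ₁)) * D ^ 2 * (t₁ - t₀)) := by
  have hT : 0 < t₁ - t₀ := sub_pos.2 ht₀₁
  have hA := agmonConst_nonneg
  set β : ℝ := 27 * agmonConst ^ 4 / (2 * ν ^ 3) with hβdef
  have hβ : 0 ≤ β := by positivity
  -- the translated window `[0, t₁ − t₀]`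
  have hpre : (fun s => s + t₀) ⁻¹' Icc t₀ t₁ = Icc 0 (t₁ - t₀) := by
    rw [Set.preimage_add_const_Icc, sub_self]
  have hmem : ∀ {s}, s ∈ Icc 0 (t₁ - t₀) → s + t₀ ∈ Icc t₀ t₁ := fun hs =>
    ⟨by linarith [hs.1], by linarith [hs.2]⟩
  have hmaps : MapsTo (fun s => s + t₀) (Icc 0 (t₁ - t₀)) (Icc t₀ t₁) := fun s hs => hmem hs
  have hz : (fun s => (0 : ℝ → EuclideanSpace ℝ (Fin 3) → EuclideanSpace ℝ (Fin 3)) (s + t₀)) =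
      (0 : ℝ → EuclideanSpace ℝ (Fin 3) → EuclideanSpace ℝ (Fin 3)) := rfl
  have hu' : IsClassicalNSSolutionOn (Icc 0 (t₁ - t₀)) ν 0 (fun s => u (s + t₀)) (fun s => p (s + t₀)) := by
    have h := hu.comp_add_right t₀
    rw [hpre, hz] at h
    exact h
  have hv' : IsClassicalNSSolutionOn (Icc 0 (t₁ - t₀)) ν 0 (fun s => v (s + t₀)) (fun s => q (s + t₀)) := by
    have h := hv.comp_add_right t₀
    rw [hpre, hz] at h
    exact h
  have hIcc : Icc t₀ t₁ = Icc (0 + t₀) (t₁ - t₀ + t₀) := by rw [zero_add, sub_add_cancel]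
  have hU' : HasBoundedSobolevNormsOn (Icc 0 (t₁ - t₀)) (fun s => u (s + t₀)) := by
    rw [hIcc] at hU
    exact HasBoundedSobolevNormsOn.comp_add_right t₀ hU
  have hV' : HasBoundedSobolevNormsOn (Icc 0 (t₁ - t₀)) (fun s => v (s + t₀)) := by
    rw [hIcc] at hV
    exact HasBoundedSobolevNormsOn.comp_add_right t₀ hV
  have hWeq : ∀ (w : ℝ → EuclideanSpace ℝ (Fin 3) → EuclideanSpace ℝ (Fin 3)),
      timeDerivWithin (Icc 0 (t₁ - t₀)) (fun s => w (s + t₀)) =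
        fun s => timeDerivWithin (Icc t₀ t₁) w (s + t₀) := by
    intro w
    funext s x
    rw [← hpre]
    exact timeDerivWithin_comp_add_right (Icc t₀ t₁) w t₀ s x
  have hUt' : HasBoundedSobolevNormsOn (Icc 0 (t₁ - t₀))
      (timeDerivWithin (Icc 0 (t₁ - t₀)) (fun s => u (s + t₀))) := by
    rw [hWeq u]
    have h2 : ∀ n : ℕ, ∃ C : ℝ≥0, ∀ s ∈ Icc (0 + t₀) (t₁ - t₀ + t₀),
        ∫⁻ x, ‖iteratedFDeriv ℝ n (timeDerivWithin (Icc t₀ t₁) u s) x‖ₑ ^ 2 ≤ C := by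
      rw [← hIcc]; exact hUt
    exact bounds_comp_add h2
  have hVt' : HasBoundedSobolevNormsOn (Icc 0 (t₁ - t₀))
      (timeDerivWithin (Icc 0 (t₁ - t₀)) (fun s => v (s + t₀))) := by
    rw [hWeq v]
    have h2 : ∀ n : ℕ, ∃ C : ℝ≥0, ∀ s ∈ Icc (0 + t₀) (t₁ - t₀ + t₀),
        ∫⁻ x, ‖iteratedFDeriv ℝ n (timeDerivWithin (Icc t₀ t₁) v s) x‖ₑ ^ 2 ≤ C := by
      rw [← hIcc]; exact hVt
    exact bounds_comp_add h2
  have hp' : ∀ n : ℕ, ∃ C : ℝ≥0, ∀ s ∈ Icc 0 (t₁ - t₀),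
      ∫⁻ x, ‖iteratedFDeriv ℝ n (p (s + t₀)) x‖ₑ ^ 2 ≤ C := by
    rw [hIcc] at hp
    exact bounds_comp_add hp
  have hq' : ∀ n : ℕ, ∃ C : ℝ≥0, ∀ s ∈ Icc 0 (t₁ - t₀),
      ∫⁻ x, ‖iteratedFDeriv ℝ n (q (s + t₀)) x‖ₑ ^ 2 ≤ C := by
    rw [hIcc] at hq
    exact bounds_comp_add hq
  -- the translated rate and envelope
  have cadd : Continuous fun s : ℝ => s + t₀ := continuous_id.add continuous_const
  have hlc' : ContinuousOn (fun s => l (s + t₀)) (Icc 0 (t₁ - t₀)) := hlc.comp cadd.continuousOn hmaps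
  have hl0 : ∀ s ∈ Icc t₀ t₁, 0 ≤ l s := fun s hs => by
    obtain ⟨M, hM0, -, hle⟩ := hl s hs
    have : 0 ≤ 2 * M ^ 2 / ν + 27 * agmonConst ^ 4 * (∫ x, frobeniusNormSq (fderiv ℝ (u s) x)) ^ 2 / (2 * ν ^ 3) := by
      positivity
    linarith
  have hΛ : ∀ s ∈ Icc 0 (t₁ - t₀),
      HasDerivWithinAt (fun r => ∫ x in (0 : ℝ)..r, l (x + t₀)) (l (s + t₀)) (Icc 0 (t₁ - t₀)) s := fun s hs =>
    hasDerivWithinAt_intervalIntegral_Icc hlc' hs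
  -- change of variables in the envelope, and its monotonicity
  have eΛ : ∀ r, (∫ x in (0 : ℝ)..r, l (x + t₀)) = ∫ s in t₀..(r + t₀), l s := fun r => by
    rw [intervalIntegral.integral_comp_add_right l, zero_add]
  have hΛle : ∀ r ∈ Icc 0 (t₁ - t₀), (∫ x in (0 : ℝ)..r, l (x + t₀)) ≤ Λ₁ := by
    intro r hr
    rw [eΛ]
    refine le_trans ?_ hΛ₁
    have hint : IntervalIntegrable l volume t₀ t₁ := (hlc.mono le_rfl).intervalIntegrable_of_Icc ht₀₁.le
    exact intervalIntegral.integral_mono_interval le_rfl (by linarith [hr.1]) (by linarith [hr.2])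
      ((ae_restrict_mem measurableSet_Ioc).mono fun s hs => hl0 s ⟨hs.1.le, hs.2⟩) hint
  -- the slicewise rate hypothesis along the translated reference
  have hl' : ∀ s ∈ Icc 0 (t₁ - t₀), ∃ M : ℝ, 0 ≤ M ∧ (∀ x, ‖u (s + t₀) x‖ ≤ M) ∧
      2 * M ^ 2 / ν + 27 * agmonConst ^ 4 * (∫ x, frobeniusNormSq (fderiv ℝ (u (s + t₀)) x)) ^ 2 / (2 * ν ^ 3) ≤
        l (s + t₀) := fun s hs => hl (s + t₀) (hmem hs)
  -- the translated slices at `t − t₀` and `0`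
  have hr : t - t₀ ∈ Icc 0 (t₁ - t₀) := ⟨sub_nonneg.2 ht.1, sub_le_sub_right ht.2 _⟩
  have hT' : t₁ - t₀ ∈ Icc 0 (t₁ - t₀) := ⟨hT.le, le_rfl⟩
  have e1 : ((fun s => v (s + t₀)) - fun s => u (s + t₀)) (t - t₀) = (v - u) t := by
    funext x
    simp only [Pi.sub_apply, sub_add_cancel]
  have e0 : ((fun s => v (s + t₀)) - fun s => u (s + t₀)) 0 = (v - u) t₀ := by
    funext x
    simp only [Pi.sub_apply, zero_add]
  set X₀ : ℝ := ∫ x, frobeniusNormSq (fderiv ℝ ((v - u) t₀) x) with hX₀def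
  have hX₀ : 0 ≤ X₀ := integral_nonneg fun x => frobeniusNormSq_nonneg _
  have hD0 : 0 ≤ D := hX₀.trans hD
  -- monotonicity of the constants
  have h1 : Real.exp (2 * (fun r => ∫ x in (0 : ℝ)..r, l (x + t₀)) (t₁ - t₀)) ≤ Real.exp (2 * Λ₁) :=
    Real.exp_le_exp.2 (by linarith [hΛle (t₁ - t₀) hT'])
  have h2 : X₀ ^ 2 ≤ D ^ 2 := pow_le_pow_left₀ hX₀ hD 2
  have hmono : ∀ r : ℝ, 0 ≤ r → r ≤ t₁ - t₀ →
      2 * (27 * agmonConst ^ 4 / (2 * ν ^ 3) * Real.exp (2 * (fun r => ∫ x in (0 : ℝ)..r, l (x + t₀)) (t₁ - t₀))) *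
          X₀ ^ 2 * r ≤
        2 * (27 * agmonConst ^ 4 / (2 * ν ^ 3) * Real.exp (2 * Λ₁)) * D ^ 2 * (t₁ - t₀) := by
    intro r hr0 hr1
    have hβ : 0 ≤ 27 * agmonConst ^ 4 / (2 * ν ^ 3) := by positivity
    calc 2 * (27 * agmonConst ^ 4 / (2 * ν ^ 3) * Real.exp (2 * (fun r => ∫ x in (0 : ℝ)..r, l (x + t₀)) (t₁ - t₀))) *
          X₀ ^ 2 * r
        ≤ 2 * (27 * agmonConst ^ 4 / (2 * ν ^ 3) * Real.exp (2 * Λ₁)) * D ^ 2 * r :=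
          mul_le_mul_of_nonneg_right (mul_le_mul (mul_le_mul_of_nonneg_left
            (mul_le_mul_of_nonneg_left h1 hβ) (by norm_num)) h2 (sq_nonneg _) (by positivity)) hr0
      _ ≤ 2 * (27 * agmonConst ^ 4 / (2 * ν ^ 3) * Real.exp (2 * Λ₁)) * D ^ 2 * (t₁ - t₀) :=
          mul_le_mul_of_nonneg_left hr1 (by positivity)
  have hsmall' : 2 * (27 * agmonConst ^ 4 / (2 * ν ^ 3) *
      Real.exp (2 * (fun r => ∫ x in (0 : ℝ)..r, l (x + t₀)) (t₁ - t₀))) *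
      (∫ x, frobeniusNormSq (fderiv ℝ (((fun s => v (s + t₀)) - fun s => u (s + t₀)) 0) x)) ^ 2 * (t₁ - t₀) < 1 := by
    rw [e0]
    exact (hmono (t₁ - t₀) hT.le le_rfl).trans_lt hsmall
  have key := robustness_slab hν hT hv' hu' hU' hUt' hp' hV' hVt' hq' hlc' hl' hΛ
    (by simp only [intervalIntegral.integral_same]) hsmall' hr
  rw [e1, e0] at key
  refine key.trans (div_le_div₀ (by positivity) ?_ ?_ ?_)
  · exact mul_le_mul (Real.exp_le_exp.2 (hΛle (t - t₀) hr)) hD hX₀ (Real.exp_pos _).le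
  · exact Real.sqrt_pos.2 (by linarith)
  · exact Real.sqrt_le_sqrt (by linarith [hmono (t - t₀) hr.1 hr.2])

end Robustness

end ReferenceShadowing

end RigidExit

end Summit.NavierStokesRegularity.NavierStokesRegularity.Theorems

end
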